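import Summits.BirchSwinnertonDyer.Rank1Residual.Supersingular.MazurTateLambdaReading
import HarnessLib

/-!
# Single-layer EXACTNESS and the forced `μ(θ_n) ≥ 1` phenomenon: what a given `(μ, λ)(L^•)`
# predicts for EVERY Mazur–Tate element `θ_n` (layer-consistency of the census's certificates)
# (cell `b2b-bsdres`, supersingular family, prover B = unit `b2b-bsdres-additive-p3`, gen 4)

HONEST FRAMING (run/shared/lean/b2b/bsd-rank1-residual/, verbatim in every file): the goal of the
cell is to DELETE the COMBINATION-SHAPED residual classes of the Birch–Swinnerton-Dyer formula for
ALL analytic-rank `≤ 1` elliptic curves over `ℚ` — "full BSD formula for every rank `≤ 1` curve in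
class `C`" assembled STRICTLY from published theorems — so that the rank-`≤ 1` remainder becomes
exactly the CONSTRUCTION-SHAPED classes, which are TYPED (missing-input `Prop`s), NOT attempted.
This is not "finishing BSD". THEOREMS ONLY; nothing about any curve is asserted; nothing booked;
labels unchanged. Census-support bookkeeping (instrument seats iw-2 / harvest-1 / hyp).

## What this file proves (the converse direction of `MazurTateReduction` / `MazurTateLambdaReading`)

Parts 1–2 (p214499, p214576) read `(μ, λ)(L^•)` OFF one layer: `θ_n ≠ 0`, `μ(θ_n) = 0`,
`λ(θ_n) < pⁿ` ⇒ `μ(L^•) = 0`, `λ(L^•) = λ(θ_n) − deg ω_n^±`. Here, conversely, GIVEN `μ(L^•) = 0`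
(`L^• ≠ 0`), every layer is PREDICTED:
* `natDegree_mazurTateElement_le` — `deg θ_n ≤ pⁿ − 1` (the canonical representative mod `ω_n`);
  `coeff_eq_zero_of_iwasawaToPowerSeries_eq` — so the element `Θ ∈ Λ` with `ι Θ = θ_n` is a
  polynomial of degree `< pⁿ`;
* **`lam_mazurTate_eq_of_lam_sharp` / `_flat` (SINGLE-LAYER EXACTNESS)**: at every layer `n` of
  the right parity with `λ(L^•) + deg ω_n^± < pⁿ`: `θ_n ≢ 0 (mod p)` and
  `λ(θ_n) = deg ω_n^± + λ(L^•)` EXACTLY — no stabilisation, the same value at all admissible layers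
  (the consistency check across iw-2's per-layer columns `B_odd_layers` / `B_even_layers`);
* **`mu_mazurTate_pos_of_le_sharp` / `_flat` (FORCED `μ ≥ 1`)**: at layers with
  `λ(L^•) + deg ω_n^± ≥ pⁿ` the Mazur–Tate element is `≡ 0 (mod p)` (`Θ = 0 ∨ μ(Θ) > 0`): its
  reduction has order `≥ pⁿ` but degree `< pⁿ`. This is why a per-layer census entry "`n : v`"
  (engine B's `λ(θ_n / p^{μ(θ_n)}) − q_n`) certifies `λ(L^•) = v` ONLY together with `μ(θ_n) = 0` at
  that layer (example in `ss_signed_by_epsilon.tsv`: 2150r1@3, `λ♯ = 3 ≥ 3¹ − 0`, shows "n=1:1"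
  with `θ_1 ≡ 0 mod 3`).
In `𝔽_p⟦T⟧`: `θ̄_n = T^{pⁿ} Q̄ ∓ T^{deg ω_n^±} L̄^•` (parts 1–2); if `deg + ord L̄^• < pⁿ` the second
term wins, else both terms have order `≥ pⁿ > deg θ_n`.

References: [Pollack2003] Prop. 6.9–6.10, Cor. 6.10 ("for `n` large enough"); [Sprung2017] §3
(invariants `μ_±, λ_±` "stabilise"), Cor. 3.6; [PollackWeston2011] Thm. 4.1; L. Washington, GTM 83, §7.1.
Memo: `HOME/b2b-bsdres-additive-p3/X8-ROUTE-B.md` §9 (gen 4); INBOX 2026-08-20T10:30Z (certificate shape).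
-/

set_option autoImplicit false

noncomputable section

open scoped Classical MatrixGroups ModularForm

open CongruenceSubgroup Polynomial WeierstrassCurve Literature.NumberTheory.EllipticCurves
  Literature.NumberTheory.EllipticCurves.ModularForms
  Literature.NumberTheory.EllipticCurves.Sprung2017
  Summit.BirchSwinnertonDyer.Rank1Residual.X1.MuLambda

namespace Summit.BirchSwinnertonDyer.Rank1Residual.Supersingular

/-! ## §1. The degree of `θ_n` and the truncation of `Θ` -/

section Degree

variable {N : ℕ} (f : CuspForm (Gamma0 N) 2) (p : ℕ) [hp : Fact p.Prime]

/-- **`deg θ_n ≤ pⁿ − 1`**: the Mazur–Tate element is `∑_η ∑_{s mod pⁿ} c (1+T)^{s}` with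
`s` represented in `[0, pⁿ)` (Pollack 2003 Def. 6.15 / Rem. 6.16: the canonical representative modulo
`ω_n`). [cite: Pollack2003, Def. 6.15 and Remark 6.16] -/
theorem natDegree_mazurTateElement_le (n : ℕ) :
    (mazurTateElement f p n).natDegree ≤ p ^ n - 1 := by
  classical
  haveI := neZero_torsionOrder p
  haveI := Fintype.ofFinite (rootsOfUnity (torsionOrder p) ℤ_[p])
  haveI : NeZero (p ^ n) := ⟨pow_ne_zero _ hp.out.ne_zero⟩
  rw [mazurTateElement, finsum_eq_sum_of_fintype]
  refine Polynomial.natDegree_sum_le_of_forall_le _ _ fun η _ ↦ ?_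
  refine Polynomial.natDegree_sum_le_of_forall_le _ _ fun s _ ↦ ?_
  refine (Polynomial.natDegree_C_mul_le _ _).trans ?_
  refine (Polynomial.natDegree_pow_le).trans ?_
  have h1 : (X + 1 : ℚ[X]).natDegree = 1 := by rw [← C_1, Polynomial.natDegree_X_add_C]
  rw [h1, mul_one]
  have := ZMod.val_lt s
  omega

/-- `deg θ_n < pⁿ`. [cite: Pollack2003, Def. 6.15 and Remark 6.16] -/
theorem natDegree_mazurTateElement_lt (n : ℕ) : (mazurTateElement f p n).natDegree < p ^ n := by
  have h := natDegree_mazurTateElement_le f p n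
  have h1 : 1 ≤ p ^ n := Nat.one_le_pow _ _ hp.out.pos
  omega

variable {f p}

/-- If `ι Θ = θ_n` then `Θ` has no coefficients in degrees `≥ pⁿ`. [cite: Pollack2003, Def. 6.15 and Remark 6.16] -/
theorem coeff_eq_zero_of_iwasawaToPowerSeries_eq {n : ℕ} {Θ : IwasawaAlgebra p}
    (hΘ : iwasawaToPowerSeries p Θ =
      ((mazurTateElement f p n).map (algebraMap ℚ ℚ_[p]) : PowerSeries ℚ_[p]))
    {i : ℕ} (hi : p ^ n ≤ i) : PowerSeries.coeff i Θ = 0 := by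
  have h := congrArg (PowerSeries.coeff i) hΘ
  rw [iwasawaToPowerSeries, PowerSeries.coeff_map, Polynomial.coeff_coe, Polynomial.coeff_map,
    Polynomial.coeff_eq_zero_of_natDegree_lt (lt_of_lt_of_le (natDegree_mazurTateElement_lt f p n) hi),
    map_zero] at h
  exact (injective_iff_map_eq_zero _).mp (IsFractionRing.injective ℤ_[p] ℚ_[p]) _ h

end Degree

/-! ## §2. The converse bookkeeping in `𝔽_p⟦T⟧` and in `Λ` -/

section Converse

variable {p : ℕ} [hp : Fact p.Prime]

/-- If `Θ̄ = T^M Q̄ + U Ā` with `ord_T(U Ā) < M` then `ord_T Θ̄ = ord_T U + ord_T Ā`. [folklore] -/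
theorem order_eq_of_eq_X_pow_mul_add_of_lt {k : Type*} [Field k] {Θ Q U A : PowerSeries k} {M : ℕ}
    (hΘ : Θ = PowerSeries.X ^ M * Q + U * A) (hlt : (U * A).order < M) :
    Θ.order = U.order + A.order := by
  have hXQ : (M : ℕ∞) ≤ (PowerSeries.X ^ M * Q).order := by
    rw [PowerSeries.order_mul, PowerSeries.order_X_pow]
    exact le_self_add
  have hne : (PowerSeries.X ^ M * Q).order ≠ (U * A).order :=
    (ne_of_lt (lt_of_lt_of_le hlt hXQ)).symm
  rw [hΘ, PowerSeries.order_add_of_order_ne _ _ hne, min_eq_right (le_trans hlt.le hXQ),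
    PowerSeries.order_mul]

/-- If `Θ̄ = T^M Q̄ + U Ā` with `ord_T(U Ā) ≥ M` then `ord_T Θ̄ ≥ M`. [folklore] -/
theorem le_order_of_eq_X_pow_mul_add_of_le {k : Type*} [Field k] {Θ Q U A : PowerSeries k} {M : ℕ}
    (hΘ : Θ = PowerSeries.X ^ M * Q + U * A) (hle : (M : ℕ∞) ≤ (U * A).order) :
    (M : ℕ∞) ≤ Θ.order := by
  have hXQ : (M : ℕ∞) ≤ (PowerSeries.X ^ M * Q).order := by
    rw [PowerSeries.order_mul, PowerSeries.order_X_pow]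
    exact le_self_add
  rw [hΘ]
  exact le_trans (le_min hXQ hle) (PowerSeries.min_order_le_order_add _ _)

/-- A power series with no coefficients in degrees `≥ M` and order `≥ M` is `0`. [folklore] -/
theorem eq_zero_of_le_order_of_coeff_eq_zero {k : Type*} [Field k] {g : PowerSeries k} {M : ℕ}
    (hord : (M : ℕ∞) ≤ g.order) (hcoeff : ∀ i, M ≤ i → PowerSeries.coeff i g = 0) : g = 0 := by
  ext i
  rw [map_zero]
  rcases lt_or_ge i M with hi | hi
  · exact PowerSeries.coeff_of_lt_order i (lt_of_lt_of_le (by exact_mod_cast hi) hord)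
  · exact hcoeff i hi

/-- `ord_T (c · T^d) = d` for a non-zero constant `c`. [folklore] -/
private theorem order_C_mul_X_pow' {k : Type*} [Field k] {c : k} (hc : c ≠ 0) (d : ℕ) :
    (PowerSeries.C c * PowerSeries.X ^ d).order = (d : ℕ∞) := by
  rw [PowerSeries.order_mul, PowerSeries.order_X_pow, ← PowerSeries.monomial_zero_eq_C_apply,
    PowerSeries.order_monomial_of_ne_zero 0 c hc]
  simp

/-- **Direct reading, odd level (`♯`)**: `Θ = ω_n Q − (u_n A + v_n B)`, `p ∣ a_p`, `n` odd, `A ≠ 0`,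
`μ(A) = 0` and `λ(A) + deg ω_n^+ < pⁿ` ⇒ `Θ ≠ 0`, `μ(Θ) = 0` and `λ(Θ) = λ(A) + deg ω_n^+`.
[cite: Pollack2003, Prop. 6.9 and Prop. 6.10] [cite: Sprung2017, §3 (the invariants μ_±, λ_±) and Cor. 3.6] -/
theorem lam_eq_lam_add_of_mu_eq_zero_of_odd {ap : ℤ} (hap : (p : ℤ) ∣ ap) {n : ℕ} (hn : Odd n)
    {A B Q Θ : IwasawaAlgebra p}
    (hΘ : Θ = toIwasawa p (cyclotomicOmega p n) * Q -
      (toIwasawa p (sharpPoly ap p n) * A + toIwasawa p (flatPoly ap p n) * B))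
    (hA0 : A ≠ 0) (hμA : mu A = 0) (hlt : lam A + (cyclotomicOmegaPlus p n).natDegree < p ^ n) :
    Θ ≠ 0 ∧ mu Θ = 0 ∧ lam Θ = lam A + (cyclotomicOmegaPlus p n).natDegree := by
  have hredA : red A ≠ 0 := red_ne_zero_of_mu_eq_zero hA0 hμA
  obtain ⟨-, hlamA⟩ := mu_eq_zero_and_lam_eq_of_red_ne_zero hredA
  have hc : (-(-1 : IsLocalRing.ResidueField ℤ_[p]) ^ (n / 2)) ≠ 0 :=
    neg_ne_zero.mpr (pow_ne_zero _ (neg_ne_zero.mpr one_ne_zero))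
  set U : PowerSeries (IsLocalRing.ResidueField ℤ_[p]) :=
    PowerSeries.C (-(-1 : IsLocalRing.ResidueField ℤ_[p]) ^ (n / 2)) *
      PowerSeries.X ^ (cyclotomicOmegaPlus p n).natDegree with hU_def
  have hred : red Θ = PowerSeries.X ^ (p ^ n) * red Q + U * red A := by
    rw [hΘ, red, map_sub, map_mul, map_add, map_mul, map_mul]
    change red (toIwasawa p (cyclotomicOmega p n)) * red Q -
        (red (toIwasawa p (sharpPoly ap p n)) * red A + red (toIwasawa p (flatPoly ap p n)) * red B) = _
    rw [red_toIwasawa_cyclotomicOmega, red_toIwasawa_sharpPoly_of_odd hap hn,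
      red_toIwasawa_flatPoly_of_odd hap hn, zero_mul, add_zero, hU_def, map_neg, map_pow, map_neg,
      map_one]
    ring
  have hUord : U.order = (cyclotomicOmegaPlus p n).natDegree := order_C_mul_X_pow' hc _
  have hUA : (U * red A).order < (p ^ n : ℕ) := by
    rw [PowerSeries.order_mul, hUord, ← hlamA, ← Nat.cast_add]
    exact_mod_cast (by omega : (cyclotomicOmegaPlus p n).natDegree + lam A < p ^ n)
  have hord : (red Θ).order = ((lam A + (cyclotomicOmegaPlus p n).natDegree : ℕ) : ℕ∞) := by
    rw [order_eq_of_eq_X_pow_mul_add_of_lt hred hUA, hUord, ← hlamA, Nat.cast_add, add_comm]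
  have hredΘ : red Θ ≠ 0 := by
    intro h0
    rw [h0, PowerSeries.order_zero] at hord
    exact ENat.top_ne_coe _ hord
  have hΘ0 : Θ ≠ 0 := by
    rintro rfl
    exact hredΘ (by simp [red])
  obtain ⟨hμΘ, hlamΘ⟩ := mu_eq_zero_and_lam_eq_of_red_ne_zero hredΘ
  refine ⟨hΘ0, hμΘ, ?_⟩
  have h : (lam Θ : ℕ∞) = ((lam A + (cyclotomicOmegaPlus p n).natDegree : ℕ) : ℕ∞) := by
    rw [hlamΘ, hord]
  exact_mod_cast h

/-- **Direct reading, even level (`♭`)**: the same with `n` even, `B`, `deg ω_n^-`.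
[cite: Pollack2003, Prop. 6.9 and Prop. 6.10] [cite: Sprung2017, §3 (the invariants μ_±, λ_±) and Cor. 3.6] -/
theorem lam_eq_lam_add_of_mu_eq_zero_of_even {ap : ℤ} (hap : (p : ℤ) ∣ ap) {n : ℕ} (hn : Even n)
    {A B Q Θ : IwasawaAlgebra p}
    (hΘ : Θ = toIwasawa p (cyclotomicOmega p n) * Q -
      (toIwasawa p (sharpPoly ap p n) * A + toIwasawa p (flatPoly ap p n) * B))
    (hB0 : B ≠ 0) (hμB : mu B = 0) (hlt : lam B + (cyclotomicOmegaMinus p n).natDegree < p ^ n) :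
    Θ ≠ 0 ∧ mu Θ = 0 ∧ lam Θ = lam B + (cyclotomicOmegaMinus p n).natDegree := by
  have hredB : red B ≠ 0 := red_ne_zero_of_mu_eq_zero hB0 hμB
  obtain ⟨-, hlamB⟩ := mu_eq_zero_and_lam_eq_of_red_ne_zero hredB
  have hc : (-(-1 : IsLocalRing.ResidueField ℤ_[p]) ^ (n / 2)) ≠ 0 :=
    neg_ne_zero.mpr (pow_ne_zero _ (neg_ne_zero.mpr one_ne_zero))
  set U : PowerSeries (IsLocalRing.ResidueField ℤ_[p]) :=
    PowerSeries.C (-(-1 : IsLocalRing.ResidueField ℤ_[p]) ^ (n / 2)) *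
      PowerSeries.X ^ (cyclotomicOmegaMinus p n).natDegree with hU_def
  have hred : red Θ = PowerSeries.X ^ (p ^ n) * red Q + U * red B := by
    rw [hΘ, red, map_sub, map_mul, map_add, map_mul, map_mul]
    change red (toIwasawa p (cyclotomicOmega p n)) * red Q -
        (red (toIwasawa p (sharpPoly ap p n)) * red A + red (toIwasawa p (flatPoly ap p n)) * red B) = _
    rw [red_toIwasawa_cyclotomicOmega, red_toIwasawa_sharpPoly_of_even hap hn,
      red_toIwasawa_flatPoly_of_even hap hn, zero_mul, zero_add, hU_def, map_neg, map_pow, map_neg,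
      map_one]
    ring
  have hUord : U.order = (cyclotomicOmegaMinus p n).natDegree := order_C_mul_X_pow' hc _
  have hUB : (U * red B).order < (p ^ n : ℕ) := by
    rw [PowerSeries.order_mul, hUord, ← hlamB, ← Nat.cast_add]
    exact_mod_cast (by omega : (cyclotomicOmegaMinus p n).natDegree + lam B < p ^ n)
  have hord : (red Θ).order = ((lam B + (cyclotomicOmegaMinus p n).natDegree : ℕ) : ℕ∞) := by
    rw [order_eq_of_eq_X_pow_mul_add_of_lt hred hUB, hUord, ← hlamB, Nat.cast_add, add_comm]
  have hredΘ : red Θ ≠ 0 := by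
    intro h0
    rw [h0, PowerSeries.order_zero] at hord
    exact ENat.top_ne_coe _ hord
  have hΘ0 : Θ ≠ 0 := by
    rintro rfl
    exact hredΘ (by simp [red])
  obtain ⟨hμΘ, hlamΘ⟩ := mu_eq_zero_and_lam_eq_of_red_ne_zero hredΘ
  refine ⟨hΘ0, hμΘ, ?_⟩
  have h : (lam Θ : ℕ∞) = ((lam B + (cyclotomicOmegaMinus p n).natDegree : ℕ) : ℕ∞) := by
    rw [hlamΘ, hord]
  exact_mod_cast h

/-- **Forced `μ ≥ 1`, odd level (`♯`)**: if `A ≠ 0`, `μ(A) = 0` but `λ(A) + deg ω_n^+ ≥ pⁿ`, and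
`Θ = ω_n Q − (u_n A + v_n B)` has no coefficients in degrees `≥ pⁿ` (a Mazur–Tate element), then
`Θ ≡ 0 (mod p)`: `Θ = 0 ∨ μ(Θ) > 0`. [cite: Pollack2003, Prop. 6.9 and Prop. 6.10] -/
theorem eq_zero_or_mu_pos_of_le_of_odd {ap : ℤ} (hap : (p : ℤ) ∣ ap) {n : ℕ} (hn : Odd n)
    {A B Q Θ : IwasawaAlgebra p}
    (hΘ : Θ = toIwasawa p (cyclotomicOmega p n) * Q -
      (toIwasawa p (sharpPoly ap p n) * A + toIwasawa p (flatPoly ap p n) * B))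
    (hA0 : A ≠ 0) (hμA : mu A = 0) (hge : p ^ n ≤ lam A + (cyclotomicOmegaPlus p n).natDegree)
    (hcoeff : ∀ i, p ^ n ≤ i → PowerSeries.coeff i Θ = 0) : Θ = 0 ∨ 0 < mu Θ := by
  have hredA : red A ≠ 0 := red_ne_zero_of_mu_eq_zero hA0 hμA
  obtain ⟨-, hlamA⟩ := mu_eq_zero_and_lam_eq_of_red_ne_zero hredA
  have hc : (-(-1 : IsLocalRing.ResidueField ℤ_[p]) ^ (n / 2)) ≠ 0 :=
    neg_ne_zero.mpr (pow_ne_zero _ (neg_ne_zero.mpr one_ne_zero))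
  set U : PowerSeries (IsLocalRing.ResidueField ℤ_[p]) :=
    PowerSeries.C (-(-1 : IsLocalRing.ResidueField ℤ_[p]) ^ (n / 2)) *
      PowerSeries.X ^ (cyclotomicOmegaPlus p n).natDegree with hU_def
  have hred : red Θ = PowerSeries.X ^ (p ^ n) * red Q + U * red A := by
    rw [hΘ, red, map_sub, map_mul, map_add, map_mul, map_mul]
    change red (toIwasawa p (cyclotomicOmega p n)) * red Q -
        (red (toIwasawa p (sharpPoly ap p n)) * red A + red (toIwasawa p (flatPoly ap p n)) * red B) = _
    rw [red_toIwasawa_cyclotomicOmega, red_toIwasawa_sharpPoly_of_odd hap hn,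
      red_toIwasawa_flatPoly_of_odd hap hn, zero_mul, add_zero, hU_def, map_neg, map_pow, map_neg,
      map_one]
    ring
  have hUord : U.order = (cyclotomicOmegaPlus p n).natDegree := order_C_mul_X_pow' hc _
  have hUA : ((p ^ n : ℕ) : ℕ∞) ≤ (U * red A).order := by
    rw [PowerSeries.order_mul, hUord, ← hlamA, ← Nat.cast_add]
    exact_mod_cast (by omega : p ^ n ≤ (cyclotomicOmegaPlus p n).natDegree + lam A)
  have hord := le_order_of_eq_X_pow_mul_add_of_le hred hUA
  have hred0 : red Θ = 0 :=
    eq_zero_of_le_order_of_coeff_eq_zero hord fun i hi ↦ by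
      rw [red, PowerSeries.coeff_map, hcoeff i hi, map_zero]
  by_contra h
  rw [not_or, not_lt, Nat.le_zero] at h
  exact red_ne_zero_of_mu_eq_zero h.1 h.2 hred0

/-- **Forced `μ ≥ 1`, even level (`♭`)**: the same with `n` even, `B`, `deg ω_n^-`.
[cite: Pollack2003, Prop. 6.9 and Prop. 6.10] -/
theorem eq_zero_or_mu_pos_of_le_of_even {ap : ℤ} (hap : (p : ℤ) ∣ ap) {n : ℕ} (hn : Even n)
    {A B Q Θ : IwasawaAlgebra p}
    (hΘ : Θ = toIwasawa p (cyclotomicOmega p n) * Q -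
      (toIwasawa p (sharpPoly ap p n) * A + toIwasawa p (flatPoly ap p n) * B))
    (hB0 : B ≠ 0) (hμB : mu B = 0) (hge : p ^ n ≤ lam B + (cyclotomicOmegaMinus p n).natDegree)
    (hcoeff : ∀ i, p ^ n ≤ i → PowerSeries.coeff i Θ = 0) : Θ = 0 ∨ 0 < mu Θ := by
  have hredB : red B ≠ 0 := red_ne_zero_of_mu_eq_zero hB0 hμB
  obtain ⟨-, hlamB⟩ := mu_eq_zero_and_lam_eq_of_red_ne_zero hredB
  have hc : (-(-1 : IsLocalRing.ResidueField ℤ_[p]) ^ (n / 2)) ≠ 0 :=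
    neg_ne_zero.mpr (pow_ne_zero _ (neg_ne_zero.mpr one_ne_zero))
  set U : PowerSeries (IsLocalRing.ResidueField ℤ_[p]) :=
    PowerSeries.C (-(-1 : IsLocalRing.ResidueField ℤ_[p]) ^ (n / 2)) *
      PowerSeries.X ^ (cyclotomicOmegaMinus p n).natDegree with hU_def
  have hred : red Θ = PowerSeries.X ^ (p ^ n) * red Q + U * red B := by
    rw [hΘ, red, map_sub, map_mul, map_add, map_mul, map_mul]
    change red (toIwasawa p (cyclotomicOmega p n)) * red Q -
        (red (toIwasawa p (sharpPoly ap p n)) * red A + red (toIwasawa p (flatPoly ap p n)) * red B) = _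
    rw [red_toIwasawa_cyclotomicOmega, red_toIwasawa_sharpPoly_of_even hap hn,
      red_toIwasawa_flatPoly_of_even hap hn, zero_mul, zero_add, hU_def, map_neg, map_pow, map_neg,
      map_one]
    ring
  have hUord : U.order = (cyclotomicOmegaMinus p n).natDegree := order_C_mul_X_pow' hc _
  have hUB : ((p ^ n : ℕ) : ℕ∞) ≤ (U * red B).order := by
    rw [PowerSeries.order_mul, hUord, ← hlamB, ← Nat.cast_add]
    exact_mod_cast (by omega : p ^ n ≤ (cyclotomicOmegaMinus p n).natDegree + lam B)
  have hord := le_order_of_eq_X_pow_mul_add_of_le hred hUB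
  have hred0 : red Θ = 0 :=
    eq_zero_of_le_order_of_coeff_eq_zero hord fun i hi ↦ by
      rw [red, PowerSeries.coeff_map, hcoeff i hi, map_zero]
  by_contra h
  rw [not_or, not_lt, Nat.le_zero] at h
  exact red_ne_zero_of_mu_eq_zero h.1 h.2 hred0

end Converse

/-! ## §3. For the Mazur–Tate elements of `E` and THE Sprung pair -/

section MazurTate

variable {W : WeierstrassCurve ℚ} [W.IsElliptic] [W.IsGloballyMinimal] {N : ℕ} [NeZero N]
  {f : CuspForm (Gamma0 N) 2} {p : ℕ} [hp : Fact p.Prime]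

/-- **SINGLE-LAYER EXACTNESS for `L♯`.** At an odd supersingular prime, `f` the newform, ANY (= the
unique) Sprung pair with `L♯ ≠ 0`, `μ(L♯) = 0`: at EVERY odd layer `n` with `λ(L♯) + deg ω_n^+ < pⁿ`,
the Mazur–Tate element (as `Θ ∈ Λ` with `ι Θ = θ_n`) is `≢ 0 (mod p)` and
`λ(θ_n) = deg ω_n^+ + λ(L♯)` exactly. [cite: Pollack2003, Prop. 6.9 and Prop. 6.10] [cite: Sprung2017, §3 and Cor. 3.6] -/
theorem lam_mazurTate_eq_of_lam_sharp (hp2 : p ≠ 2) (hf : IsNewformOf W f)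
    (hgood : W.HasGoodReductionAtPrime p) (hap : (p : ℤ) ∣ W.frobeniusTrace p)
    {Lsharp Lflat : IwasawaAlgebra p} (hSP : IsSprungPair f p (W.frobeniusTrace p) Lsharp Lflat)
    (hL0 : Lsharp ≠ 0) (hμL : mu Lsharp = 0) {n : ℕ} (hn : Odd n)
    (hlt : lam Lsharp + (cyclotomicOmegaPlus p n).natDegree < p ^ n) {Θ : IwasawaAlgebra p}
    (hΘ : iwasawaToPowerSeries p Θ =
      ((mazurTateElement f p n).map (algebraMap ℚ ℚ_[p]) : PowerSeries ℚ_[p])) :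
    Θ ≠ 0 ∧ mu Θ = 0 ∧ lam Θ = lam Lsharp + (cyclotomicOmegaPlus p n).natDegree := by
  obtain ⟨Q, hQ⟩ := exists_integral_mazurTate_of_isSprungPair hp2 hf hgood hap hSP n
  exact lam_eq_lam_add_of_mu_eq_zero_of_odd hap hn (iwasawaToPowerSeries_injective p (hΘ.trans hQ))
    hL0 hμL hlt

/-- **SINGLE-LAYER EXACTNESS for `L♭`** (even layers, `deg ω_n^-`). [cite: Pollack2003, Prop. 6.9 and Prop. 6.10] [cite: Sprung2017, §3 and Cor. 3.6] -/
theorem lam_mazurTate_eq_of_lam_flat (hp2 : p ≠ 2) (hf : IsNewformOf W f)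
    (hgood : W.HasGoodReductionAtPrime p) (hap : (p : ℤ) ∣ W.frobeniusTrace p)
    {Lsharp Lflat : IwasawaAlgebra p} (hSP : IsSprungPair f p (W.frobeniusTrace p) Lsharp Lflat)
    (hL0 : Lflat ≠ 0) (hμL : mu Lflat = 0) {n : ℕ} (hn : Even n)
    (hlt : lam Lflat + (cyclotomicOmegaMinus p n).natDegree < p ^ n) {Θ : IwasawaAlgebra p}
    (hΘ : iwasawaToPowerSeries p Θ =
      ((mazurTateElement f p n).map (algebraMap ℚ ℚ_[p]) : PowerSeries ℚ_[p])) :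
    Θ ≠ 0 ∧ mu Θ = 0 ∧ lam Θ = lam Lflat + (cyclotomicOmegaMinus p n).natDegree := by
  obtain ⟨Q, hQ⟩ := exists_integral_mazurTate_of_isSprungPair hp2 hf hgood hap hSP n
  exact lam_eq_lam_add_of_mu_eq_zero_of_even hap hn (iwasawaToPowerSeries_injective p (hΘ.trans hQ))
    hL0 hμL hlt

/-- **FORCED `μ(θ_n) ≥ 1` for `L♯`**: at odd layers with `λ(L♯) + deg ω_n^+ ≥ pⁿ` the Mazur–Tate
element is `≡ 0 (mod p)` (`Θ = 0 ∨ μ(Θ) > 0`). [cite: Pollack2003, Prop. 6.9 and Prop. 6.10] -/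
theorem mazurTate_eq_zero_or_mu_pos_of_le_sharp (hp2 : p ≠ 2) (hf : IsNewformOf W f)
    (hgood : W.HasGoodReductionAtPrime p) (hap : (p : ℤ) ∣ W.frobeniusTrace p)
    {Lsharp Lflat : IwasawaAlgebra p} (hSP : IsSprungPair f p (W.frobeniusTrace p) Lsharp Lflat)
    (hL0 : Lsharp ≠ 0) (hμL : mu Lsharp = 0) {n : ℕ} (hn : Odd n)
    (hge : p ^ n ≤ lam Lsharp + (cyclotomicOmegaPlus p n).natDegree) {Θ : IwasawaAlgebra p}
    (hΘ : iwasawaToPowerSeries p Θ =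
      ((mazurTateElement f p n).map (algebraMap ℚ ℚ_[p]) : PowerSeries ℚ_[p])) :
    Θ = 0 ∨ 0 < mu Θ := by
  obtain ⟨Q, hQ⟩ := exists_integral_mazurTate_of_isSprungPair hp2 hf hgood hap hSP n
  exact eq_zero_or_mu_pos_of_le_of_odd hap hn (iwasawaToPowerSeries_injective p (hΘ.trans hQ)) hL0 hμL
    hge fun i hi ↦ coeff_eq_zero_of_iwasawaToPowerSeries_eq hΘ hi

/-- **FORCED `μ(θ_n) ≥ 1` for `L♭`** (even layers, `deg ω_n^-`). [cite: Pollack2003, Prop. 6.9 and Prop. 6.10] -/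
theorem mazurTate_eq_zero_or_mu_pos_of_le_flat (hp2 : p ≠ 2) (hf : IsNewformOf W f)
    (hgood : W.HasGoodReductionAtPrime p) (hap : (p : ℤ) ∣ W.frobeniusTrace p)
    {Lsharp Lflat : IwasawaAlgebra p} (hSP : IsSprungPair f p (W.frobeniusTrace p) Lsharp Lflat)
    (hL0 : Lflat ≠ 0) (hμL : mu Lflat = 0) {n : ℕ} (hn : Even n)
    (hge : p ^ n ≤ lam Lflat + (cyclotomicOmegaMinus p n).natDegree) {Θ : IwasawaAlgebra p}
    (hΘ : iwasawaToPowerSeries p Θ =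
      ((mazurTateElement f p n).map (algebraMap ℚ ℚ_[p]) : PowerSeries ℚ_[p])) :
    Θ = 0 ∨ 0 < mu Θ := by
  obtain ⟨Q, hQ⟩ := exists_integral_mazurTate_of_isSprungPair hp2 hf hgood hap hSP n
  exact eq_zero_or_mu_pos_of_le_of_even hap hn (iwasawaToPowerSeries_injective p (hΘ.trans hQ)) hL0 hμL
    hge fun i hi ↦ coeff_eq_zero_of_iwasawaToPowerSeries_eq hΘ hi

end MazurTate

end Summit.BirchSwinnertonDyer.Rank1Residual.Supersingular

end
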